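import Summits.CriticalPhenomena.PercolationContinuityZ3.Theorems.PercNearOneGluingNoHeavyQuantGluedWindowDiagCore
import HarnessLib

/-!
# QUANT lane R8, T-DEC: LEMMA W's two-row regime — the POOL-MINUS inequality of the DIAGONAL certificate (`h+r` a giant, the middle copy light for `h`
# and LIGHTER for `h` than the pair at `T₀`: it ships into the pool at the discounted rate of `(l+r, h)` and under-uses its share), reduced to five
# variables by monotonicity in `ν` and closed by an 82-term Handelman certificate (arm-1 gen 62, architect)

builds on p205010 (kernel theorem, internal audit signed; external expert review pending)

Support file (`--supports stmt-CriticalPhenomena-4575`), QUANT lane seat prim-quant-arm-1 (gen 62, architect); memo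
`run/shared/lean/prim/quant/prim-quant-arm-1-g62/ARCH-G62.md` §2–§3.  Pure real algebra; standard axioms, no sorries, no definitions.

SETTING (companion of `diag_poolLight`, `…QuantGluedWindowNoTopGiant` p642893): pool capacity `γ(t₁+t₂)` at power `(1−y)/y`; row `l` ↦ `h` at the heavy
power, leftover `≤ t₀(1−γ/ν)`; row `l+r` ↦ pool at the exact light power of `(l+r, h)`, ratio `ρ_h = (ν−2ε)/(1−ε)`, gate `G_h = y² + (1−y)ρ_h ≤ γ`
(`ρ_h ≤ ρ₀`).  Claim: `t₀(1−γ/ν)·y/(1−y) + t₁(G_h−γ)/(1−G_h) ≤ γt₂` (the second term is ≤ 0).  Band fact (c12) `t₀ν + t₁(ν−ε) ≤ ρ₀` with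
`ν − ε = (ν(1−ρ_h) + ρ_h)/(2−ρ_h)` bounds `ν ≤ D/E`, `D = ρ₀(2−ρ_h) − t₁ρ_h`, `E = t₀(2−ρ_h) + t₁(1−ρ_h)`; the claim at `ν = D/E` cleared of denominators is
the 82-term certificate **`diag_poolMinus_poly`** (kit j310941) in `(y, ρ₀, ρ_h, t₀, t₁)`.  **`diag_poolMinus`**.  Numerics: explore2/iota1.py (`V1L−`,
needs the midpoint form of (c12): explore2/v1l.py).

HONEST STATUS.  `GluedLemmaW` (flow form), `GluedDominatedMass`, the band, `SiblingStep`, `FarTreeRow` OPEN; RATE class (log\*) / honest sentence of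
`run/shared/lean/prim/quant/README.md` unchanged.  [this work].  Nothing here is cited as a published result.
-/

namespace Summit.CriticalPhenomena.PercolationContinuityZ3.Theorems
namespace Quant
namespace LawDec

set_option maxRecDepth 200000 in
/-- **cleared polynomial of `diag_poolMinus`** (`r0 = ρ₀`, `rh = ρ_h`, `D = r0(2−rh) − t₁rh`, `E = t₀(2−rh) + t₁(1−rh)`): 82-term Handelman certificate
(kit j310941) on `y, 1−y, rh, r0−rh, y−r0, t₀, t₁, t₂−y, D − yE`. [this work] -/
theorem diag_poolMinus_poly (y r0 rh t0 t1 : ℝ) (h0 : 0 ≤ y) (h1 : 0 ≤ 1 - y) (h2 : 0 ≤ rh) (h3 : 0 ≤ r0 - rh) (h4 : 0 ≤ y - r0) (h5 : 0 ≤ t0) (h6 : 0 ≤ t1) (h7 : 0 ≤ (1 - t0 - t1) - y) (h8 : 0 ≤ (r0 * (2 - rh) - t1 * rh) - y * (t0 * (2 - rh) + t1 * (1 - rh))) :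
    0 ≤ (y ^ 2 + (1 - y) * r0) * (1 - t0 - t1) * (1 - y) * (1 + y - rh) * (r0 * (2 - rh) - t1 * rh) - t0 * y * (1 + y - rh) * ((r0 * (2 - rh) - t1 * rh) - (y ^ 2 + (1 - y) * r0) * (t0 * (2 - rh) + t1 * (1 - rh))) - t1 * (1 - y) * (rh - r0) * (r0 * (2 - rh) - t1 * rh) := by
  linarith only [mul_nonneg (mul_nonneg (mul_nonneg (mul_nonneg (mul_nonneg (mul_nonneg (mul_nonneg (h0) h0) h0) h0) h0) h2) h6) (by norm_num : (0:ℝ) ≤ 13/83),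
    mul_nonneg (mul_nonneg (mul_nonneg (mul_nonneg (mul_nonneg (mul_nonneg (mul_nonneg (h0) h0) h0) h0) h2) h4) h6) (by norm_num : (0:ℝ) ≤ 43/83),
    mul_nonneg (mul_nonneg (mul_nonneg (mul_nonneg (mul_nonneg (mul_nonneg (mul_nonneg (h0) h0) h0) h0) h2) h6) h7) (by norm_num : (0:ℝ) ≤ 13/83),
    mul_nonneg (mul_nonneg (mul_nonneg (mul_nonneg (mul_nonneg (mul_nonneg (h0) h0) h0) h0) h3) h6) (by norm_num : (0:ℝ) ≤ 1244/5395),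
    mul_nonneg (mul_nonneg (mul_nonneg (mul_nonneg (mul_nonneg (mul_nonneg (h0) h0) h0) h2) h4) h4) h6,
    mul_nonneg (mul_nonneg (mul_nonneg (mul_nonneg (mul_nonneg (mul_nonneg (mul_nonneg (h0) h0) h0) h3) h3) h4) h6) (by norm_num : (0:ℝ) ≤ 801/5395),
    mul_nonneg (mul_nonneg (mul_nonneg (mul_nonneg (mul_nonneg (mul_nonneg (h0) h0) h0) h3) h4) h6) (by norm_num : (0:ℝ) ≤ 424/415),
    mul_nonneg (mul_nonneg (mul_nonneg (mul_nonneg (mul_nonneg (mul_nonneg (h0) h0) h0) h3) h6) h6) (by norm_num : (0:ℝ) ≤ 574/5395),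
    mul_nonneg (mul_nonneg (mul_nonneg (mul_nonneg (mul_nonneg (mul_nonneg (h0) h0) h0) h4) h6) h6) (by norm_num : (0:ℝ) ≤ 45/166),
    mul_nonneg (mul_nonneg (mul_nonneg (mul_nonneg (mul_nonneg (mul_nonneg (h0) h0) h0) h4) h6) h7) (by norm_num : (0:ℝ) ≤ 39/166),
    mul_nonneg (mul_nonneg (mul_nonneg (mul_nonneg (mul_nonneg (h0) h0) h0) h6) h8) (by norm_num : (0:ℝ) ≤ 13/83),
    mul_nonneg (mul_nonneg (mul_nonneg (mul_nonneg (mul_nonneg (mul_nonneg (mul_nonneg (h0) h0) h1) h1) h4) h4) h5) (by norm_num : (0:ℝ) ≤ 1/2),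
    mul_nonneg (mul_nonneg (mul_nonneg (mul_nonneg (mul_nonneg (mul_nonneg (h0) h0) h2) h3) h6) h7) (by norm_num : (0:ℝ) ≤ 134/5395),
    mul_nonneg (mul_nonneg (mul_nonneg (mul_nonneg (mul_nonneg (mul_nonneg (h0) h0) h2) h4) h5) h6) (by norm_num : (0:ℝ) ≤ 71/166),
    mul_nonneg (mul_nonneg (mul_nonneg (mul_nonneg (mul_nonneg (mul_nonneg (h0) h0) h3) h3) h5) h6) (by norm_num : (0:ℝ) ≤ 89/5395),
    mul_nonneg (mul_nonneg (mul_nonneg (mul_nonneg (mul_nonneg (mul_nonneg (h0) h0) h3) h4) h6) h7) (by norm_num : (0:ℝ) ≤ 2773/10790),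
    mul_nonneg (mul_nonneg (mul_nonneg (mul_nonneg (mul_nonneg (mul_nonneg (h0) h0) h4) h4) h6) h7) (by norm_num : (0:ℝ) ≤ 51/166),
    mul_nonneg (mul_nonneg (mul_nonneg (mul_nonneg (mul_nonneg (h0) h0) h4) h6) h6) (by norm_num : (0:ℝ) ≤ 26/83),
    mul_nonneg (mul_nonneg (mul_nonneg (mul_nonneg (h0) h0) h4) h6) h7,
    mul_nonneg (mul_nonneg (mul_nonneg (mul_nonneg (mul_nonneg (h0) h0) h4) h6) h8) (by norm_num : (0:ℝ) ≤ 95/166),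
    mul_nonneg (mul_nonneg (mul_nonneg (mul_nonneg (h0) h0) h4) h7) h8,
    mul_nonneg (mul_nonneg (mul_nonneg (mul_nonneg (h0) h0) h6) h8) (by norm_num : (0:ℝ) ≤ 26/83),
    mul_nonneg (mul_nonneg (mul_nonneg (h0) h0) h7) h8,
    mul_nonneg (mul_nonneg (mul_nonneg (mul_nonneg (mul_nonneg (mul_nonneg (h0) h1) h1) h1) h3) h6) (by norm_num : (0:ℝ) ≤ 1177/5395),
    mul_nonneg (mul_nonneg (mul_nonneg (mul_nonneg (mul_nonneg (mul_nonneg (mul_nonneg (h0) h1) h1) h2) h4) h6) h7) (by norm_num : (0:ℝ) ≤ 43/83),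
    mul_nonneg (mul_nonneg (mul_nonneg (mul_nonneg (mul_nonneg (mul_nonneg (h0) h1) h1) h3) h5) h6) (by norm_num : (0:ℝ) ≤ 1601/5395),
    mul_nonneg (mul_nonneg (mul_nonneg (mul_nonneg (mul_nonneg (h0) h1) h1) h3) h6) (by norm_num : (0:ℝ) ≤ 107/5395),
    mul_nonneg (mul_nonneg (mul_nonneg (mul_nonneg (mul_nonneg (mul_nonneg (h0) h1) h1) h4) h4) h5) (by norm_num : (0:ℝ) ≤ 3/2),
    mul_nonneg (mul_nonneg (mul_nonneg (mul_nonneg (mul_nonneg (mul_nonneg (mul_nonneg (h0) h1) h2) h2) h4) h4) h5) (by norm_num : (0:ℝ) ≤ 1/2),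
    mul_nonneg (mul_nonneg (mul_nonneg (mul_nonneg (mul_nonneg (mul_nonneg (h0) h1) h2) h2) h4) h4) h6,
    mul_nonneg (mul_nonneg (mul_nonneg (mul_nonneg (mul_nonneg (mul_nonneg (h0) h1) h2) h2) h4) h6) (by norm_num : (0:ℝ) ≤ 161/166),
    mul_nonneg (mul_nonneg (mul_nonneg (mul_nonneg (mul_nonneg (mul_nonneg (h0) h1) h2) h3) h4) h6) (by norm_num : (0:ℝ) ≤ 5391/10790),
    mul_nonneg (mul_nonneg (mul_nonneg (mul_nonneg (mul_nonneg (mul_nonneg (h0) h1) h2) h3) h5) h6) (by norm_num : (0:ℝ) ≤ 626/5395),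
    mul_nonneg (mul_nonneg (mul_nonneg (mul_nonneg (mul_nonneg (h0) h1) h2) h3) h6) (by norm_num : (0:ℝ) ≤ 516/5395),
    mul_nonneg (mul_nonneg (mul_nonneg (mul_nonneg (mul_nonneg (mul_nonneg (h0) h1) h2) h3) h6) h6) (by norm_num : (0:ℝ) ≤ 444/5395),
    mul_nonneg (mul_nonneg (mul_nonneg (mul_nonneg (mul_nonneg (mul_nonneg (h0) h1) h2) h4) h6) h7) (by norm_num : (0:ℝ) ≤ 11/166),
    mul_nonneg (mul_nonneg (mul_nonneg (mul_nonneg (mul_nonneg (h0) h1) h2) h6) h7) (by norm_num : (0:ℝ) ≤ 21/83),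
    mul_nonneg (mul_nonneg (mul_nonneg (mul_nonneg (mul_nonneg (mul_nonneg (h0) h1) h3) h3) h3) h6) (by norm_num : (0:ℝ) ≤ 67/5395),
    mul_nonneg (mul_nonneg (mul_nonneg (mul_nonneg (mul_nonneg (mul_nonneg (mul_nonneg (h0) h1) h3) h3) h4) h4) h5) (by norm_num : (0:ℝ) ≤ 1/2),
    mul_nonneg (mul_nonneg (mul_nonneg (mul_nonneg (mul_nonneg (mul_nonneg (h0) h1) h3) h4) h4) h4) h5,
    mul_nonneg (mul_nonneg (mul_nonneg (mul_nonneg (mul_nonneg (mul_nonneg (h0) h1) h3) h4) h4) h5) (by norm_num : (0:ℝ) ≤ 3),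
    mul_nonneg (mul_nonneg (mul_nonneg (mul_nonneg (mul_nonneg (mul_nonneg (h0) h1) h3) h4) h5) h6) (by norm_num : (0:ℝ) ≤ 14/415),
    mul_nonneg (mul_nonneg (mul_nonneg (mul_nonneg (mul_nonneg (h0) h1) h3) h5) h6) (by norm_num : (0:ℝ) ≤ 502/1079),
    mul_nonneg (mul_nonneg (mul_nonneg (mul_nonneg (mul_nonneg (h0) h1) h3) h6) h6) (by norm_num : (0:ℝ) ≤ 1959/5395),
    mul_nonneg (mul_nonneg (mul_nonneg (mul_nonneg (mul_nonneg (mul_nonneg (mul_nonneg (h0) h1) h4) h4) h4) h4) h5) (by norm_num : (0:ℝ) ≤ 1/2),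
    mul_nonneg (mul_nonneg (mul_nonneg (mul_nonneg (mul_nonneg (mul_nonneg (h0) h1) h4) h4) h4) h5) (by norm_num : (0:ℝ) ≤ 3),
    mul_nonneg (mul_nonneg (mul_nonneg (mul_nonneg (mul_nonneg (mul_nonneg (h0) h1) h4) h4) h4) h6) (by norm_num : (0:ℝ) ≤ 38/83),
    mul_nonneg (mul_nonneg (mul_nonneg (mul_nonneg (mul_nonneg (h0) h1) h4) h4) h5) (by norm_num : (0:ℝ) ≤ 61/166),
    mul_nonneg (mul_nonneg (mul_nonneg (mul_nonneg (mul_nonneg (h0) h1) h4) h5) h6) (by norm_num : (0:ℝ) ≤ 20/83),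
    mul_nonneg (mul_nonneg (mul_nonneg (mul_nonneg (mul_nonneg (h0) h2) h2) h4) h6) (by norm_num : (0:ℝ) ≤ 53/166),
    mul_nonneg (mul_nonneg (mul_nonneg (mul_nonneg (mul_nonneg (h0) h2) h3) h4) h6) (by norm_num : (0:ℝ) ≤ 4477/10790),
    mul_nonneg (mul_nonneg (mul_nonneg (mul_nonneg (h0) h2) h3) h6) (by norm_num : (0:ℝ) ≤ 223/5395),
    mul_nonneg (mul_nonneg (mul_nonneg (mul_nonneg (mul_nonneg (h0) h2) h3) h6) h6) (by norm_num : (0:ℝ) ≤ 134/5395),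
    mul_nonneg (mul_nonneg (mul_nonneg (mul_nonneg (mul_nonneg (h0) h3) h4) h6) h7) (by norm_num : (0:ℝ) ≤ 69/415),
    mul_nonneg (mul_nonneg (mul_nonneg (mul_nonneg (h0) h3) h6) h6) (by norm_num : (0:ℝ) ≤ 137/5395),
    mul_nonneg (mul_nonneg (mul_nonneg (mul_nonneg (h0) h3) h6) h7) (by norm_num : (0:ℝ) ≤ 1333/5395),
    mul_nonneg (mul_nonneg (mul_nonneg (mul_nonneg (h0) h3) h6) h8) (by norm_num : (0:ℝ) ≤ 849/5395),
    mul_nonneg (mul_nonneg (mul_nonneg (mul_nonneg (mul_nonneg (h0) h4) h4) h5) h5) (by norm_num : (0:ℝ) ≤ 11/83),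
    mul_nonneg (mul_nonneg (mul_nonneg (mul_nonneg (mul_nonneg (h0) h4) h4) h5) h7) (by norm_num : (0:ℝ) ≤ 11/83),
    mul_nonneg (mul_nonneg (mul_nonneg (mul_nonneg (h0) h4) h6) h6) (by norm_num : (0:ℝ) ≤ 10/83),
    mul_nonneg (mul_nonneg (mul_nonneg (h0) h6) h8) (by norm_num : (0:ℝ) ≤ 10/83),
    mul_nonneg (mul_nonneg (mul_nonneg (mul_nonneg (mul_nonneg (mul_nonneg (mul_nonneg (h1) h1) h1) h2) h4) h5) h6) (by norm_num : (0:ℝ) ≤ 9/166),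
    mul_nonneg (mul_nonneg (mul_nonneg (mul_nonneg (mul_nonneg (mul_nonneg (mul_nonneg (h1) h1) h1) h2) h4) h6) h6) (by norm_num : (0:ℝ) ≤ 9/166),
    mul_nonneg (mul_nonneg (mul_nonneg (mul_nonneg (mul_nonneg (mul_nonneg (mul_nonneg (h1) h1) h1) h3) h3) h4) h6) (by norm_num : (0:ℝ) ≤ 801/5395),
    mul_nonneg (mul_nonneg (mul_nonneg (mul_nonneg (mul_nonneg (mul_nonneg (h1) h1) h2) h2) h3) h6) (by norm_num : (0:ℝ) ≤ 67/5395),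
    mul_nonneg (mul_nonneg (mul_nonneg (mul_nonneg (mul_nonneg (h1) h1) h2) h4) h6) (by norm_num : (0:ℝ) ≤ 33/166),
    mul_nonneg (mul_nonneg (mul_nonneg (mul_nonneg (mul_nonneg (mul_nonneg (h1) h1) h3) h3) h6) h6) (by norm_num : (0:ℝ) ≤ 271/5395),
    mul_nonneg (mul_nonneg (mul_nonneg (mul_nonneg (mul_nonneg (h1) h2) h2) h2) h6) (by norm_num : (0:ℝ) ≤ 21/83),
    mul_nonneg (mul_nonneg (mul_nonneg (mul_nonneg (mul_nonneg (h1) h2) h2) h3) h6) (by norm_num : (0:ℝ) ≤ 1298/5395),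
    mul_nonneg (mul_nonneg (mul_nonneg (mul_nonneg (mul_nonneg (h1) h2) h4) h5) h6) (by norm_num : (0:ℝ) ≤ 11/83),
    mul_nonneg (mul_nonneg (mul_nonneg (mul_nonneg (h1) h2) h4) h7) h8,
    mul_nonneg (mul_nonneg (mul_nonneg (h1) h2) h7) h8,
    mul_nonneg (mul_nonneg (mul_nonneg (mul_nonneg (mul_nonneg (h1) h3) h3) h6) h6) (by norm_num : (0:ℝ) ≤ 71/1079),
    mul_nonneg (mul_nonneg (mul_nonneg (mul_nonneg (h2) h3) h4) h6) (by norm_num : (0:ℝ) ≤ 62/5395),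
    mul_nonneg (mul_nonneg (mul_nonneg (mul_nonneg (h2) h4) h5) h6) (by norm_num : (0:ℝ) ≤ 10/83),
    mul_nonneg (mul_nonneg (mul_nonneg (mul_nonneg (h2) h4) h6) h7) (by norm_num : (0:ℝ) ≤ 51/166),
    mul_nonneg (mul_nonneg (mul_nonneg (h2) h6) h8) (by norm_num : (0:ℝ) ≤ 21/83),
    mul_nonneg (mul_nonneg (mul_nonneg (mul_nonneg (h3) h4) h4) h6) (by norm_num : (0:ℝ) ≤ 801/5395),
    mul_nonneg (mul_nonneg (mul_nonneg (h3) h4) h6) (by norm_num : (0:ℝ) ≤ 1478/5395),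
    mul_nonneg (mul_nonneg (mul_nonneg (mul_nonneg (h3) h4) h6) h6) (by norm_num : (0:ℝ) ≤ 626/5395),
    mul_nonneg (mul_nonneg (mul_nonneg (h3) h6) h8) (by norm_num : (0:ℝ) ≤ 6134/5395),
    mul_nonneg (mul_nonneg (h3) h7) h8]

/-- **POOL-MINUS INEQUALITY** (ι = 1, middle copy light for `h` and lighter than the pair at `T₀`): `0 < y < 1`, `0 < ρ_h ≤ ρ₀ ≤ y ≤ ν`,
`ρ_h(1−ε) = ν − 2ε`, `t₀, t₁ ≥ 0`, `t₂ = 1−t₀−t₁ ≥ y`, (c12) `t₀ν + t₁(ν−ε) ≤ ρ₀` ⟹ `t₀(1−γ/ν)·y/(1−y) + t₁(G_h−γ)/(1−G_h) ≤ γt₂`. [this work] -/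
theorem diag_poolMinus (y ρ rh t0 t1 n e : ℝ) (hy0 : 0 < y) (hy1 : y < 1) (hrh0 : 0 < rh) (hrhρ : rh ≤ ρ) (hρy : ρ ≤ y) (hn : y ≤ n)
    (hrel : rh * (1 - e) = n - 2 * e) (ht0 : 0 ≤ t0) (ht1 : 0 ≤ t1) (ht2 : y ≤ 1 - t0 - t1)
    (hc12 : t0 * n + t1 * (n - e) ≤ ρ) :
    t0 * (1 - (y ^ 2 + (1 - y) * ρ) / n) * (y / (1 - y)) + t1 * ((y ^ 2 + (1 - y) * rh) - (y ^ 2 + (1 - y) * ρ)) / (1 - (y ^ 2 + (1 - y) * rh))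
      ≤ (y ^ 2 + (1 - y) * ρ) * (1 - t0 - t1) := by
  obtain ⟨g, hg⟩ : ∃ g : ℝ, g = y ^ 2 + (1 - y) * ρ := ⟨_, rfl⟩
  obtain ⟨H, hH⟩ : ∃ H : ℝ, H = y ^ 2 + (1 - y) * rh := ⟨_, rfl⟩
  have h1y : 0 < 1 - y := by linarith
  have hρ0 : 0 < ρ := lt_of_lt_of_le hrh0 hrhρ
  have hg0 : 0 < g := by rw [hg]; positivity
  have hn0 : 0 < n := lt_of_lt_of_le hy0 hn
  have hrhy : rh ≤ y := le_trans hrhρ hρy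
  have hHy : H ≤ y := by rw [hH]; nlinarith [mul_le_mul_of_nonneg_left hrhy h1y.le]
  have hH1 : 0 < 1 - H := by linarith
  have hHg : H ≤ g := by rw [hH, hg]; nlinarith [mul_le_mul_of_nonneg_left hrhρ h1y.le]
  rw [← hg, ← hH]
  obtain ⟨D, hD⟩ : ∃ D : ℝ, D = ρ * (2 - rh) - t1 * rh := ⟨_, rfl⟩
  obtain ⟨E, hE⟩ : ∃ E : ℝ, E = t0 * (2 - rh) + t1 * (1 - rh) := ⟨_, rfl⟩
  -- (c12) × (2 − ρ_h):  ν E ≤ D, using (ν − ε)(2 − ρ_h) = ν(1 − ρ_h) + ρ_h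
  have hem : (n - e) * (2 - rh) = n * (1 - rh) + rh := by nlinarith [hrel]
  have hnE : n * E ≤ D := by
    have h1 := mul_le_mul_of_nonneg_right hc12 (show (0:ℝ) ≤ 2 - rh by linarith)
    rw [hD, hE]; nlinarith [h1, hem]
  have hE0 : 0 ≤ E := by rw [hE]; nlinarith
  have hDpos : 0 < D := by
    have : y * E ≤ D := le_trans (mul_le_mul_of_nonneg_right hn hE0) hnE
    rw [hD]; nlinarith [mul_pos hρ0 (show (0:ℝ) < 2 - rh by linarith), this, hE0]
  -- the second term is ≤ 0; if E = 0 then t0 = t1 = 0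
  rcases eq_or_lt_of_le hE0 with hEz | hEpos
  · have ht0z : t0 = 0 := by rw [hE] at hEz; nlinarith
    have ht1z : t1 = 0 := by rw [hE] at hEz; nlinarith
    rw [ht0z, ht1z]; simp only [zero_mul, zero_div, add_zero, sub_zero, mul_one]; exact hg0.le
  -- ν ≤ D/E, so t0 (1 − g/ν) ≤ t0 (1 − g E/D)
  have step1 : t0 * (1 - g / n) * (y / (1 - y)) ≤ t0 * (1 - g * E / D) * (y / (1 - y)) := by
    refine mul_le_mul_of_nonneg_right (mul_le_mul_of_nonneg_left ?_ ht0) (div_nonneg hy0.le h1y.le)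
    have : g * E / D ≤ g / n := by rw [div_le_div_iff₀ hDpos hn0]; nlinarith [mul_le_mul_of_nonneg_left hnE hg0.le]
    linarith
  have P := diag_poolMinus_poly y ρ rh t0 t1 hy0.le h1y.le hrh0.le (by linarith) (by linarith) ht0 ht1 (by linarith)
    (by rw [← hD, ← hE]; linarith [mul_le_mul_of_nonneg_right hn hE0, hnE])
  rw [← hg, ← hD, ← hE] at P
  -- divide the certificate by (1−y)(1+y−rh) D > 0
  have h1H : 1 - H = (1 - y) * (1 + y - rh) := by rw [hH]; ring
  have hHg' : H - g = (1 - y) * (rh - ρ) := by rw [hH, hg]; ring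
  have hyr : 0 < 1 + y - rh := by linarith
  have step2 : (t0 * (1 - g * E / D) * (y / (1 - y)) + t1 * (H - g) / (1 - H)) * ((1 - y) * (1 + y - rh) * D)
      ≤ g * (1 - t0 - t1) * ((1 - y) * (1 + y - rh) * D) := by
    have e1 : t0 * (1 - g * E / D) * (y / (1 - y)) * ((1 - y) * (1 + y - rh) * D) = t0 * y * (1 + y - rh) * (D - g * E) := by
      field_simp
    have e2 : t1 * (H - g) / (1 - H) * ((1 - y) * (1 + y - rh) * D) = t1 * (1 - y) * (rh - ρ) * D := by
      rw [h1H, hHg']; field_simp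
    rw [add_mul, e1, e2]; linarith [P]
  have step3 := le_of_mul_le_mul_right step2 (by positivity)
  linarith [step1, step3]

end LawDec
end Quant
end Summit.CriticalPhenomena.PercolationContinuityZ3.Theorems
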